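import Summits.QuantumFields.BalabanUV.Beta.FP.PerfectBubbleSandwich
import Summits.QuantumFields.BalabanUV.Beta.D1BFx.ReducedKernelSandwichLeg

/-!
# `BalabanUV.Beta.FP.PerfectFullSandwich` — road «FP» for binder row D1, leaf N7 ∕ `hrep` (REP∞), sub-leaf ALG-2b «FULL FINE KERNEL» (owner's
# `REP-DESIGN.md` v1.2 (P1): the fine Ward identity (T0) is a property of the FULL fine kernel — tadpole AND bubble together — not of the
# bubble alone): WITH THE SECOND-ORDER SLOT IN THE EXPLICIT BI-VERTEX FORM `W := vertex2OfK K n Wf` (the pure second-order summand of the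
# wall family's carrier `SecondOrderResponse.W2OfK`, UNDRESSED `ℋ`-columns), THE WHOLE PERFECT ONE-LOOP KERNEL `TPerfOf n K S W` IS THE
# SANDWICH OF leaf-01's FULL FINE HESSIAN TABLE `fineHessA (Π K Π) (Πᵀ S) Wf = tadpoleTableA + bubbleTableA` BY THE PERFECT COLUMN, AND
# (K-R5, `d = 4`) ITS (1.22) SECOND MOMENT IS `n⁻⁸ ×` THE BASE-POINT AVERAGE OF THE FINE SECOND MOMENT — GIVEN WARD ROWS OF THE FULL KERNEL

HONEST FRAMING (cell contract, verbatim): «discharging `BetaPertH` makes Bałaban's UV stability UNCONDITIONAL — a real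
constructive-QFT result; it is NOT the continuum limit and NOT the Clay problem.»  [folklore] bookkeeping composed BY NAME from the tree:
`SecondOrderResponse.vertex2OfK`, `DressedTadpoleTable.tadpole_wsum_wsum` ∕ `biLoc_wsum_fst∕snd`, `KernelWardRelative.tadpole_finset_sum`,
leaf-01's `DressedTablesLeg.tadpoleTableA` (+ `exists_decay_tadpoleTableA`, `absMoment₂_baseKer_tadpoleTableA`) and
`ReducedKernelSandwichLeg.fineHessA` (+ `fineHessA_transpose`, `absMoment₂_baseKer_fineHessA`), `ReducedKernelSandwich.dressedEntryP_add`,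
K-R5 `MomentTransferPeriodicEntry.bondSecondMomentP_tsum_four`, this seat's `PerfectBubbleSandwich` (p218953: bubble half, coarse periodicity,
`EntryHyps` letters of the base-`0` column) and `PerfectBubbleExpansion.colH_of_blockCov` (p218590).  No definition, no `def … : Prop`,
nothing cited, nothing of the manuscripts under audit asserted.  HYPOTHESES THAT STAY HYPOTHESES (named, not minted): the class data and
coarse covariance ∕ symmetry of the fine bi-table `Wf`, the WARD ROWS `hrow` of the FULL fine kernel (the owner's (P1)∕N3-fine: «gauge
covariance of the blocked fine system — bubble and tadpole TOGETHER»), the base-point-summed first moments `hT1`; whether road FP's perfect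
table `WPerfOf` HAS the form `vertex2OfK K n Wf + (mixed ∕ response summands of W2OfK)` is leaf N0b-W (open) — NOT asserted; the mixed and
response summands (`mixOfK`, `dM (K2OfK …)`; road BF-x R-3's «RESP × ONE-POINT» class) are NOT covered here.  0 estimates of leaf N7 proved;
0∕4 binders of row D1.  Value = kernel bookkeeping for road FP (`REP-DESIGN.md` v1.2 rows ALG-2 + (P1); claim table
`HOME/b2b-balaban-beta-d1-p3/LEAVES-FP.md` sub-row REP-ALG-2b), NOT summit progress; NOT `hrep`, NOT D1, NOT BetaPertH, NOT continuum, NOT Clay.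
HONEST DEPENDENCY (verbatim): continuum YM on T⁴ ⇐ BetaPertH ∧ nine spine estimates (0/9 proved); BetaPertH ⇐ (D1) ∧ (D4) ∧
CAP+tail; G-an2-4 gates asym, D1 and NE2/3/4.
CONTENT (all [folklore]):
* §1 (fibre `Fib d`) `summable_abs_colH`, `abs_wsum_le`, `abs_table_le`, **`vertex2OfK_eq_sum_wsum`** — the bi-vertex as the DOUBLE finite
  sum of double superpositions (the inner finite sum exchanged with the outer series under domination).
* §2 (`d = 3`) `isBlockPeriodic_tadpoleTableA_coarse`, `isBlockPeriodic_fineHessA_coarse` (block periodicity from COARSE covariance only).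
* §3 `loc_summand_vertex2OfK`, **`tadpole_vertex2OfK`** (`tadpole A (vertex2OfK K n Wf μ y ν y′) = Σ_{κ′λ′} Σ'_{(u,u′)} colH·colH·tadpole A (Wf κ′ u λ′ u′)`).
* §4 **`tadpolePart_TPerfOf_eq_dressedEntryP`**, **`TPerfOf_vertex2OfK_eq_dressedEntryP`** (`TPerfOf n K S (vertex2OfK K n Wf) μ ν z =
  dressedEntryP (c a ↦ colH K n a 0 c) (fineHessA (Π K Π) (Πᵀ S) Wf) (n•(−z)) μ ν`).
* §5 `hasSum_col_fineHessA`, **`bondSecondMoment_TPerfOf_eq_avgM2`**, **`secondMoment_TPerfOf_vertex2OfK_eq`** (K-R5 with the column weights: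
  `secondMoment (TPerfOf n K S (vertex2OfK K n Wf)) κ λ`-shape `Σ'_z T μ ν z·z_κ·z_λ = n⁻⁸·avgM2 n (fineHessA … μ ν) κ λ` GIVEN `hrow`, `hT1`).
* §6 **`secondMoment_TPerfOf_perfect_eq`** — at `K := KPerf Lc (sfStep Lc) (smStep 3 Lc) m`, `n := Lc^m`: every K-side letter discharged. -/

namespace Summit.QuantumFields.BalabanUV.Beta.FP.PerfectFullSandwich

open Finset
open Literature.MathematicalPhysics.QuantumFieldTheory.Balaban1983to89
open Literature.MathematicalPhysics.QuantumFieldTheory.Balaban1983to89.Beta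
open B12Sec2to5 (l1 l1_nonneg Decay510)
open ExpKernelCalculus (Site MKer Decays BiLoc comp tr bubble tadpole hessKer VertexFamily VertexFamily₂ shiftK tadpole_shiftK Zl Zl_nonneg
  summable_exp_shift')
open DecimatedMoment (cosetInd)
open DecimatedMomentSummable (AbsMoment₂ ConstReproSum LinReproSum absMoment₂_of_decay510)
open DressedMomentNormalisation (EKer resSite EntryHyps)
open OneStepResolventKernel (Fib wsum LocStencil)
open OneStepKernelFamily (colH vertexOfK abs_colH_le)
open AxialProjector (coProj)
open AxialDressing (axDressK axVertexOfK decays_axDressK locStencil_coProj cN')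
open SecondOrderResponse (vertex2OfK)
open Summit.QuantumFields.BalabanUV.Beta.TameKernelCalculus
open Summit.QuantumFields.BalabanUV.Beta.GAN24.CombesThomas (sfStep smStep)
open Summit.QuantumFields.BalabanUV.Beta.KernelWardRelative (loc_finset_sum tadpole_finset_sum)
open Summit.QuantumFields.BalabanUV.Beta.D1BFx.DressedBubbleBridge (summable_abs_of_expWeight expWeight_of_le)
open Summit.QuantumFields.BalabanUV.Beta.D1BFx.DressedTadpoleTable (biLoc_wsum_snd biLoc_wsum_fst tadpole_wsum_wsum)
open Summit.QuantumFields.BalabanUV.Beta.D1BFx.MomentTransferPeriodic (Ker₂ IsBlockPeriodic baseKer)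
open Summit.QuantumFields.BalabanUV.Beta.D1BFx.MomentTransferPeriodicSum (dressedSumP)
open Summit.QuantumFields.BalabanUV.Beta.D1BFx.MomentTransferPeriodicEntry (EKer₂ dressedEntryP avgM2 bondSecondMomentP_tsum_four)
open Summit.QuantumFields.BalabanUV.Beta.D1BFx.ReducedKernelSandwich (dressedEntryP_add)
open Summit.QuantumFields.BalabanUV.Beta.D1BFx.DressedTablesLeg (bubbleTableA bubbleTableA_apply tadpoleTableA tadpoleTableA_apply
  absMoment₂_baseKer_bubbleTableA absMoment₂_baseKer_tadpoleTableA)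
open Summit.QuantumFields.BalabanUV.Beta.D1BFx.ReducedKernelSandwichLeg (fineHessA fineHessA_apply fineHessA_transpose
  absMoment₂_baseKer_fineHessA)
open Summit.QuantumFields.BalabanUV.Beta.FP.PerfectObjectsT (KPerf TPerfOf)
open Summit.QuantumFields.BalabanUV.Beta.FP.TransportInfinityM (colOf)
open Summit.QuantumFields.BalabanUV.Beta.FP.StepLawKHolds (exists_decays_KPerf_holds)
open Summit.QuantumFields.BalabanUV.Beta.FP.SymmetryK (shiftK_KPerf)
open Summit.QuantumFields.BalabanUV.Beta.FP.PerfectBubbleExpansion (expWeight_colH colH_of_blockCov)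
open Summit.QuantumFields.BalabanUV.Beta.FP.PerfectBubbleSandwich (axDressK_blockCov coProj_translate isBlockPeriodic_bubbleTableA_coarse
  constReproSum_colH_zero linReproSum_colH_zero absMoment₂_colH_zero bubblePart_TPerfOf_eq_dressedEntryP entryHyps_perfCol_zero)

noncomputable section

/-! ## §1 The bi-vertex as a double finite sum of double superpositions -/

section BiVertex

variable {d : ℕ}

/-- [folklore] The `ℋ`-column weights of a decaying kernel are absolutely summable. -/
theorem summable_abs_colH {N : ℕ} {K : MKer (d + 1) (Fib d)} {C δ : ℝ} (hK : Decays K C δ) (hδ : 0 < δ) (μ : Fin (d + 1))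
    (y : Fin (d + 1) → ℤ) (κ' : Fin (d + 1)) : Summable fun u => |colH K N μ y κ' u| :=
  summable_abs_of_expWeight (expWeight_colH hK N μ y κ') hδ

/-- [folklore] A superposition of a uniformly bounded family with absolutely summable weights is bounded entrywise by `(Σ'|w|)·B`. -/
theorem abs_wsum_le {D : ℕ} {F : Type*} {w : (Fin D → ℤ) → ℝ} {T : (Fin D → ℤ) → MKer D F} (hw : Summable fun u => |w u|) {B : ℝ}
    (hT : ∀ u x z a b, |T u x z a b| ≤ B) (x z : Fin D → ℤ) (a b : F) :
    |wsum w T x z a b| ≤ (∑' u, |w u|) * B := by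
  unfold OneStepResolventKernel.wsum
  have hB : 0 ≤ B := (abs_nonneg _).trans (hT 0 x z a b)
  have hs : Summable fun u => |w u| * B := hw.mul_right B
  have hb := tsum_of_norm_bounded hs.hasSum (fun u => by
    rw [Real.norm_eq_abs, abs_mul]; exact mul_le_mul_of_nonneg_left (hT u x z a b) (abs_nonneg _))
  rw [Real.norm_eq_abs] at hb
  refine hb.trans (le_of_eq ?_)
  rw [tsum_mul_right]

/-- [folklore] Entries of a table family bi-localised in leaf-01's currency `BiLoc (Wf κ′ u λ′ u′) u u′ C2 δ2` are bounded by `C2`. -/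
theorem abs_table_le {D : ℕ} {F : Type*} {Wf : Fin D → (Fin D → ℤ) → Fin D → (Fin D → ℤ) → MKer D F} {C2 δ2 : ℝ}
    (hW : ∀ κ' u l' u', BiLoc (Wf κ' u l' u') u u' C2 δ2) (hδ2 : 0 ≤ δ2) (κ' : Fin D) (u : Fin D → ℤ) (l' : Fin D) (u' : Fin D → ℤ)
    (x z : Fin D → ℤ) (a b : F) : |Wf κ' u l' u' x z a b| ≤ C2 := by
  have hC2 : 0 ≤ C2 := (hW κ' u l' u').nonneg a
  refine ((hW κ' u l' u') x z a b).trans ?_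
  have he : Real.exp (-δ2 * (l1 (x - u) + l1 (z - u'))) ≤ 1 := by
    rw [Real.exp_le_one_iff]
    nlinarith [l1_nonneg (x - u), l1_nonneg (z - u')]
  calc C2 * Real.exp (-δ2 * (l1 (x - u) + l1 (z - u'))) ≤ C2 * 1 := mul_le_mul_of_nonneg_left he hC2
    _ = C2 := mul_one _

/-- [folklore] **THE BI-VERTEX AS A DOUBLE FINITE SUM OF DOUBLE SUPERPOSITIONS** (as a kernel):
`vertex2OfK K N Wf μ y ν y′ = Σ_{κ′} Σ_{λ′} wsum (colH K N μ y κ′) (u ↦ wsum (colH K N ν y′ λ′) (Wf κ′ u λ′))` (decaying `K`, bi-localised `Wf`;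
the finite sum over the inner bond direction `λ′` is exchanged with the outer series under domination, `Summable.tsum_finsetSum`). -/
theorem vertex2OfK_eq_sum_wsum {N : ℕ} {K : MKer (d + 1) (Fib d)} {C δ : ℝ} (hK : Decays K C δ) (hδ : 0 < δ)
    {Wf : Fin (d + 1) → (Fin (d + 1) → ℤ) → Fin (d + 1) → (Fin (d + 1) → ℤ) → MKer (d + 1) (Fib d)} {C2 δ2 : ℝ}
    (hW : ∀ κ' u l' u', BiLoc (Wf κ' u l' u') u u' C2 δ2) (hδ2 : 0 ≤ δ2)
    (μ : Fin (d + 1)) (y : Fin (d + 1) → ℤ) (ν : Fin (d + 1)) (y' : Fin (d + 1) → ℤ) :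
    vertex2OfK K N Wf μ y ν y' = ∑ κ' : Fin (d + 1), ∑ l' : Fin (d + 1),
      wsum (colH K N μ y κ') (fun u => wsum (colH K N ν y' l') (Wf κ' u l')) := by
  have hC : 0 ≤ C := hK.nonneg (Sum.inl 0)
  funext x z a b
  simp only [Finset.sum_apply]
  show (∑ κ' : Fin (d + 1), ∑' u, colH K N μ y κ' u *
      (∑ l' : Fin (d + 1), ∑' u', colH K N ν y' l' u' * Wf κ' u l' u' x z a b)) = _
  refine Finset.sum_congr rfl fun κ' _ => ?_
  have hs : ∀ l' : Fin (d + 1), Summable fun u => colH K N μ y κ' u * ∑' u', colH K N ν y' l' u' * Wf κ' u l' u' x z a b := by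
    intro l'
    have hb : ∀ u, |∑' u', colH K N ν y' l' u' * Wf κ' u l' u' x z a b| ≤ (∑' u', |colH K N ν y' l' u'|) * C2 := fun u =>
      abs_wsum_le (summable_abs_colH (N := N) hK hδ ν y' l') (fun u' x z a b => abs_table_le hW hδ2 κ' u l' u' x z a b) x z a b
    refine Summable.of_norm_bounded ((summable_abs_colH (N := N) hK hδ μ y κ').mul_right ((∑' u', |colH K N ν y' l' u'|) * C2))
      (fun u => ?_)
    rw [Real.norm_eq_abs, abs_mul]
    exact mul_le_mul_of_nonneg_left (hb u) (abs_nonneg _)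
  simp_rw [Finset.mul_sum]
  rw [Summable.tsum_finsetSum (fun l' _ => hs l')]
  rfl

end BiVertex

/-! ## §2 Block periodicity of the tadpole table and of the full fine kernel from COARSE covariance -/

section Coarse

variable {F : Type*} [Fintype F]

/-- [folklore] **BLOCK PERIODICITY OF THE TADPOLE TABLE FROM COARSE COVARIANCE ONLY** (leaf-01's `DressedTablesLeg.isBlockPeriodic_tadpoleTableA`
asks joint FINE covariance of `Wf` but uses it only at `v = n•t`). -/
theorem isBlockPeriodic_tadpoleTableA_coarse {n : ℕ} {A : MKer 4 F} (hA : ∀ t : Site 4, shiftK (-((n : ℤ) • t)) A = A)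
    {Wf : Fin 4 → Site 4 → Fin 4 → Site 4 → MKer 4 F}
    (hWcov : ∀ (κ' : Fin 4) (u : Site 4) (l' : Fin 4) (u' t : Site 4),
      Wf κ' (u + (n : ℤ) • t) l' (u' + (n : ℤ) • t) = shiftK (-((n : ℤ) • t)) (Wf κ' u l' u'))
    (κ' l' : Fin 4) : IsBlockPeriodic n (tadpoleTableA A Wf κ' l') := by
  intro t s s'
  simp only [tadpoleTableA_apply]
  rw [hWcov κ' s l' s' t]
  conv_lhs => rw [← hA t]
  rw [tadpole_shiftK]

/-- [folklore] Block periodicity of the FULL fine kernel `fineHessA A S Wf = tadpoleTableA + bubbleTableA` from coarse covariance of `A`, `S`, `Wf`. -/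
theorem isBlockPeriodic_fineHessA_coarse {n : ℕ} {A : MKer 4 F} (hA : ∀ t : Site 4, shiftK (-((n : ℤ) • t)) A = A)
    {S : Fin 4 → Site 4 → MKer 4 F} (hS : ∀ (κ' : Fin 4) (u t : Site 4), S κ' (u + (n : ℤ) • t) = shiftK (-((n : ℤ) • t)) (S κ' u))
    {Wf : Fin 4 → Site 4 → Fin 4 → Site 4 → MKer 4 F}
    (hWcov : ∀ (κ' : Fin 4) (u : Site 4) (l' : Fin 4) (u' t : Site 4),
      Wf κ' (u + (n : ℤ) • t) l' (u' + (n : ℤ) • t) = shiftK (-((n : ℤ) • t)) (Wf κ' u l' u'))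
    (κ' l' : Fin 4) : IsBlockPeriodic n (fineHessA A S Wf κ' l') := fun t s s' => by
  simp only [fineHessA_apply, isBlockPeriodic_tadpoleTableA_coarse hA hWcov κ' l' t s s',
    isBlockPeriodic_bubbleTableA_coarse hA hS κ' l' t s s']

end Coarse

/-! ## §3 The tadpole of the bi-vertex is the `ℋ ⊗ ℋ`-superposition of the fine tadpoles -/

section Tadpole

variable {n : ℕ} {K : MKer (3 + 1) (Fib 3)} {C δ : ℝ}
  {Wf : Fin (3 + 1) → (Fin (3 + 1) → ℤ) → Fin (3 + 1) → (Fin (3 + 1) → ℤ) → MKer (3 + 1) (Fib 3)} {C2 δ2 : ℝ}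

/-- [folklore] Each `(κ′, λ′)` summand of the bi-vertex is a localised kernel at `(n•y, n•y′)` (`DressedTadpoleTable.biLoc_wsum_snd∕fst`;
the `colH`-weight twin of `DressedTablesLeg.loc_summand_tableRedF`). -/
theorem loc_summand_vertex2OfK (hK : Decays K C δ) (hδ : 0 < δ) (hW : ∀ κ' u l' u', BiLoc (Wf κ' u l' u') u u' C2 δ2) (hδ2 : 0 < δ2)
    (κ' l' μ ν : Fin (3 + 1)) (y y' : Fin (3 + 1) → ℤ) :
    Loc (wsum (colH K n μ y κ') (fun u => wsum (colH K n ν y' l') (Wf κ' u l'))) := by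
  have hC : 0 ≤ C := hK.nonneg (Sum.inl 0)
  have hm : 0 < min δ δ2 := lt_min hδ hδ2
  have hin : ∀ u, BiLoc (wsum (colH K n ν y' l') (Wf κ' u l')) u ((n : ℤ) • y') (C * |C2| * Zl (3 + 1) (min δ δ2 / 2)) (min δ δ2 / 2) :=
    fun u => biLoc_wsum_snd (fun u' => expWeight_of_le (expWeight_colH hK n ν y' l') hC (min_le_left _ _) u')
      (fun u' => biLoc_of_le (hW κ' u l' u') (min_le_right _ _)) hm hC
  have hm' : 0 < min δ (min δ δ2 / 2) := lt_min hδ (half_pos hm)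
  exact ⟨(n : ℤ) • y, (n : ℤ) • y', _, _, half_pos hm',
    biLoc_wsum_fst (fun u => expWeight_of_le (expWeight_colH hK n μ y κ') hC (min_le_left _ _) u)
      (fun u => biLoc_of_le (hin u) (min_le_right _ _)) hm' hC⟩

/-- [folklore] **THE TADPOLE OF THE BI-VERTEX IS THE `ℋ ⊗ ℋ`-SUPERPOSITION OF THE FINE TADPOLES** (spread `A`, decaying `K`, bi-localised `Wf`):
`tadpole A (vertex2OfK K n Wf μ y ν y′) = Σ_{κ′λ′} Σ'_{(u,u′)} colH K n μ y κ′ u · colH K n ν y′ λ′ u′ · tadpole A (Wf κ′ u λ′ u′)` — finite additivity over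
the localised summands of §1's double sum, then `DressedTadpoleTable.tadpole_wsum_wsum` per `(κ′, λ′)`. -/
theorem tadpole_vertex2OfK {A : MKer (3 + 1) (Fib 3)} (hA : Spr A) (hK : Decays K C δ) (hδ : 0 < δ)
    (hW : ∀ κ' u l' u', BiLoc (Wf κ' u l' u') u u' C2 δ2) (hδ2 : 0 < δ2) (μ : Fin (3 + 1)) (y : Fin (3 + 1) → ℤ) (ν : Fin (3 + 1))
    (y' : Fin (3 + 1) → ℤ) :
    tadpole A (vertex2OfK K n Wf μ y ν y')
      = ∑ κ' : Fin (3 + 1), ∑ l' : Fin (3 + 1), ∑' q : (Fin (3 + 1) → ℤ) × (Fin (3 + 1) → ℤ),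
          colH K n μ y κ' q.1 * colH K n ν y' l' q.2 * tadpole A (Wf κ' q.1 l' q.2) := by
  have hC : 0 ≤ C := hK.nonneg (Sum.inl 0)
  rw [vertex2OfK_eq_sum_wsum hK hδ hW hδ2.le μ y ν y',
    tadpole_finset_sum _ hA (fun κ' => loc_finset_sum _ fun l' => loc_summand_vertex2OfK hK hδ hW hδ2 κ' l' μ ν y y')]
  refine Finset.sum_congr rfl fun κ' _ => ?_
  rw [tadpole_finset_sum _ hA (fun l' => loc_summand_vertex2OfK hK hδ hW hδ2 κ' l' μ ν y y')]
  refine Finset.sum_congr rfl fun l' _ => ?_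
  exact tadpole_wsum_wsum hA (expWeight_colH hK n μ y κ') hδ (expWeight_colH hK n ν y' l') hC hδ (fun u u' => hW κ' u l' u') hδ2

end Tadpole

/-! ## §4 The sandwich form of the tadpole half and of the whole kernel -/

section Sandwich

variable {n : ℕ} {K : MKer (3 + 1) (Fib 3)} {C δ : ℝ} {S : Fin (3 + 1) → (Fin (3 + 1) → ℤ) → MKer (3 + 1) (Fib 3)} {Cs δs : ℝ}
  {Wf : Fin (3 + 1) → (Fin (3 + 1) → ℤ) → Fin (3 + 1) → (Fin (3 + 1) → ℤ) → MKer (3 + 1) (Fib 3)} {C2 δ2 : ℝ}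

/-- [folklore] **THE TADPOLE HALF OF `TPerfOf n K S (vertex2OfK K n Wf)` IS THE SANDWICH OF THE TADPOLE TABLE** (road-FP twin of
`DressedTablesLeg.tadpolePartA_eq_dressedEntryP`): decaying, coarse-translation-invariant `K`; bi-localised, coarse-covariant `Wf`; `1 ≤ n` ⟹
`½·tadpole (Π K Π) (vertex2OfK K n Wf μ 0 ν z) = dressedEntryP (c a ↦ colH K n a 0 c) (tadpoleTableA (Π K Π) Wf) (n•(−z)) μ ν`. -/
theorem tadpolePart_TPerfOf_eq_dressedEntryP (hn : 1 ≤ n) (hK : Decays K C δ) (hδ : 0 < δ)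
    (hKcov : ∀ t : Fin (3 + 1) → ℤ, shiftK (-((n : ℤ) • t)) K = K)
    (hW : ∀ κ' u l' u', BiLoc (Wf κ' u l' u') u u' C2 δ2) (hδ2 : 0 < δ2)
    (hWcov : ∀ κ' u l' u' t, Wf κ' (u + (n : ℤ) • t) l' (u' + (n : ℤ) • t) = shiftK (-((n : ℤ) • t)) (Wf κ' u l' u'))
    (μ ν : Fin (3 + 1)) (z : Fin (3 + 1) → ℤ) :
    (1 / 2 : ℝ) * tadpole (axDressK n K) (vertex2OfK K n Wf μ 0 ν z)
      = dressedEntryP (fun c a => colH K n a 0 c) (tadpoleTableA (axDressK n K) Wf) ((n : ℤ) • (-z)) μ ν := by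
  have hA : Spr (axDressK n K) := ⟨_, δ, hδ, decays_axDressK hn hK hδ.le⟩
  rw [tadpole_vertex2OfK hA hK hδ hW hδ2 μ 0 ν z, Finset.mul_sum]
  simp only [dressedEntryP, dressedSumP]
  refine Finset.sum_congr rfl fun κ' _ => ?_
  rw [Finset.mul_sum]
  refine Finset.sum_congr rfl fun l' _ => ?_
  rw [← tsum_mul_left, ← (Equiv.prodCongr (Equiv.refl (Fin (3 + 1) → ℤ)) (Equiv.addRight ((n : ℤ) • z))).tsum_eq]
  refine tsum_congr fun q => ?_
  obtain ⟨u, x⟩ := q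
  simp only [Equiv.prodCongr_apply, Prod.map_apply, Equiv.refl_apply, Equiv.coe_addRight]
  have hper := isBlockPeriodic_tadpoleTableA_coarse (axDressK_blockCov hn hKcov) hWcov κ' l' (-z) u (x + (n : ℤ) • z)
  rw [tadpoleTableA_apply, tadpoleTableA_apply, smul_neg, show x + (n : ℤ) • z + -((n : ℤ) • z) = x by abel] at hper
  rw [colH_of_blockCov hKcov ν z l' (x + (n : ℤ) • z), add_sub_cancel_right, tadpoleTableA_apply,
    show (n : ℤ) • -z + u = u + -((n : ℤ) • z) by rw [smul_neg]; abel, hper]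
  ring

/-- [folklore] **THE WHOLE PERFECT ONE-LOOP KERNEL WITH THE BI-VERTEX IN THE SECOND-ORDER SLOT IS A SANDWICH OF THE FULL FINE KERNEL**
(road-FP twin of `ReducedKernelSandwichLeg.TOfLeg_tableRedF_eq_dressedEntryP`):
`TPerfOf n K S (vertex2OfK K n Wf) μ ν z = dressedEntryP (c a ↦ colH K n a 0 c) (fineHessA (Π K Π) (Πᵀ S) Wf) (n•(−z)) μ ν`
(§4's tadpole half + `PerfectBubbleSandwich.bubblePart_TPerfOf_eq_dressedEntryP` + `ReducedKernelSandwich.dressedEntryP_add`; the additivity needs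
absolutely summable weights — the `AbsMoment₂` letter of `colOf K`). -/
theorem TPerfOf_vertex2OfK_eq_dressedEntryP (hn : 1 ≤ n) (hK : Decays K C δ) (hδ : 0 < δ)
    (hKcov : ∀ t : Fin (3 + 1) → ℤ, shiftK (-((n : ℤ) • t)) K = K) (hwA : ∀ κ l : Fin 4, AbsMoment₂ (colOf K κ l))
    (hS : LocStencil S Cs δs) (hδs : 0 < δs) (hScov : ∀ κ u t, S κ (u + (n : ℤ) • t) = shiftK (-((n : ℤ) • t)) (S κ u))
    (hW : ∀ κ' u l' u', BiLoc (Wf κ' u l' u') u u' C2 δ2) (hδ2 : 0 < δ2)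
    (hWcov : ∀ κ' u l' u' t, Wf κ' (u + (n : ℤ) • t) l' (u' + (n : ℤ) • t) = shiftK (-((n : ℤ) • t)) (Wf κ' u l' u'))
    (μ ν : Fin (3 + 1)) (z : Fin (3 + 1) → ℤ) :
    TPerfOf n K S (vertex2OfK K n Wf) μ ν z
      = dressedEntryP (fun c a => colH K n a 0 c) (fineHessA (axDressK n K) (coProj n S) Wf) ((n : ℤ) • (-z)) μ ν := by
  have hA : Spr (axDressK n K) := ⟨_, δ, hδ, decays_axDressK hn hK hδ.le⟩
  have hS' : ∀ κ u, BiLoc (coProj n S κ u) u u (cN' 3 n δs * Cs) δs := fun κ u => locStencil_coProj hn hS hδs.le κ u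
  have hadd := dressedEntryP_add (N := n) (by omega) (fun c a => colH K n a 0 c) (tadpoleTableA (axDressK n K) Wf)
    (bubbleTableA (axDressK n K) (coProj n S)) (fun κ l => absMoment₂_colH_zero hwA κ l)
    (fun c e => isBlockPeriodic_tadpoleTableA_coarse (axDressK_blockCov hn hKcov) hWcov c e)
    (fun c e => isBlockPeriodic_bubbleTableA_coarse (axDressK_blockCov hn hKcov) (coProj_translate hn hScov) c e)
    (fun c e b => absMoment₂_baseKer_tadpoleTableA (axDressK n K) hA hW hδ2 c e b)
    (fun c e b => absMoment₂_baseKer_bubbleTableA (axDressK n K) hA hS' hδs c e b) ((n : ℤ) • (-z)) μ ν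
  show (1 / 2 : ℝ) * tadpole (axDressK n K) (vertex2OfK K n Wf μ 0 ν z)
      - (1 / 2 : ℝ) * bubble (axDressK n K) (axVertexOfK K n S μ 0) (axVertexOfK K n S ν z) = _
  rw [sub_eq_add_neg, ← neg_mul, tadpolePart_TPerfOf_eq_dressedEntryP hn hK hδ hKcov hW hδ2 hWcov,
    bubblePart_TPerfOf_eq_dressedEntryP hn hK hδ hKcov hS hδs hScov, ← hadd]
  rfl

end Sandwich

/-! ## §5 K-R5 for the whole kernel: the (1.22) second moment is `n⁻⁸ ×` the base-point average, given Ward rows of the FULL kernel -/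

section Transport

variable {n : ℕ} {K : MKer (3 + 1) (Fib 3)} {C δ : ℝ} {S : Fin (3 + 1) → (Fin (3 + 1) → ℤ) → MKer (3 + 1) (Fib 3)} {Cs δs : ℝ}
  {Wf : Fin (3 + 1) → (Fin (3 + 1) → ℤ) → Fin (3 + 1) → (Fin (3 + 1) → ℤ) → MKer (3 + 1) (Fib 3)} {C2 δ2 : ℝ}

/-- [folklore] Rows of the FULL fine kernel summing to zero for every entry ⟹ columns summing to zero (matrix symmetry for a SYMMETRIC `Wf`,
`ReducedKernelSandwichLeg.fineHessA_transpose`). -/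
theorem hasSum_col_fineHessA (hn : 1 ≤ n) (hK : Decays K C δ) (hδ : 0 < δ) (hS : LocStencil S Cs δs) (hδs : 0 < δs)
    (hWsymm : ∀ (κ' : Fin 4) (u : Site 4) (l' : Fin 4) (u' : Site 4), Wf κ' u l' u' = Wf l' u' κ' u)
    (hrow : ∀ (κ' l' : Fin 4) (b : Site 4), HasSum (fineHessA (axDressK n K) (coProj n S) Wf κ' l' b) 0)
    (κ' l' : Fin 4) (b : Site 4) : HasSum (fun s => fineHessA (axDressK n K) (coProj n S) Wf κ' l' s b) 0 :=
  (hrow l' κ' b).congr_fun fun s => fineHessA_transpose (axDressK n K) ⟨_, δ, hδ, decays_axDressK hn hK hδ.le⟩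
    (fun κ u => locStencil_coProj hn hS hδs.le κ u) hδs hWsymm κ' l' s b

/-- [folklore] **ALG-2b, EXACT FORM — THE COARSE BOND SECOND MOMENT OF THE WHOLE PERFECT KERNEL (bi-vertex second-order slot) IS THE BASE-POINT
AVERAGE OF THE FINE SECOND MOMENT OF THE FULL FINE KERNEL.**  Decaying, coarse-translation-invariant `K` whose column `colOf K` carries the
`EntryHyps` letters; local, coarse-covariant `S`; bi-localised, coarse-covariant, SYMMETRIC `Wf`; GIVEN that every entry of
`fineHessA (Π K Π) (Πᵀ S) Wf` has ROWS SUMMING TO ZERO (`hrow` — the owner's (P1): tadpole and bubble TOGETHER) and BASE-POINT-SUMMED FIRST MOMENTS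
ZERO (`hT1`): `Σ'_z z_κ z_λ · n⁸ · TPerfOf n K S (vertex2OfK K n Wf) μ ν z = avgM2 n (fineHessA … μ ν) κ λ` — no cross term survives. -/
theorem bondSecondMoment_TPerfOf_eq_avgM2 (hn : 1 ≤ n) (hK : Decays K C δ) (hδ : 0 < δ)
    (hKcov : ∀ t : Fin (3 + 1) → ℤ, shiftK (-((n : ℤ) • t)) K = K)
    (hw0 : ∀ κ l : Fin 4, ConstReproSum n (colOf K κ l) (if κ = l then (((n : ℝ) ^ (4 + 1))⁻¹) else 0))
    (hw1 : ∀ κ l : Fin 4, ∃ C : Fin 4 → ℝ, LinReproSum n (colOf K κ l) C) (hwA : ∀ κ l : Fin 4, AbsMoment₂ (colOf K κ l))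
    (hS : LocStencil S Cs δs) (hδs : 0 < δs) (hScov : ∀ κ u t, S κ (u + (n : ℤ) • t) = shiftK (-((n : ℤ) • t)) (S κ u))
    (hW : ∀ κ' u l' u', BiLoc (Wf κ' u l' u') u u' C2 δ2) (hδ2 : 0 < δ2)
    (hWcov : ∀ κ' u l' u' t, Wf κ' (u + (n : ℤ) • t) l' (u' + (n : ℤ) • t) = shiftK (-((n : ℤ) • t)) (Wf κ' u l' u'))
    (hWsymm : ∀ (κ' : Fin 4) (u : Site 4) (l' : Fin 4) (u' : Site 4), Wf κ' u l' u' = Wf l' u' κ' u)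
    (hrow : ∀ (κ' l' : Fin 4) (b : Site 4), HasSum (fineHessA (axDressK n K) (coProj n S) Wf κ' l' b) 0)
    (hT1 : ∀ (κ' l' μ' : Fin 4), ∑ r : Fin 4 → Fin n, ∑' t, (t μ' : ℝ) *
      baseKer (fineHessA (axDressK n K) (coProj n S) Wf κ' l') (resSite r) t = 0)
    (κ lam μ ν : Fin 4) :
    ∑' z : Site 4, ((z κ * z lam : ℤ) : ℝ) * ((n : ℝ) ^ 8 * TPerfOf n K S (vertex2OfK K n Wf) μ ν z)
      = avgM2 n (fineHessA (axDressK n K) (coProj n S) Wf μ ν) κ lam := by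
  have hA : Spr (axDressK n K) := ⟨_, δ, hδ, decays_axDressK hn hK hδ.le⟩
  have hm : 0 < min δs δ2 := lt_min hδs hδ2  -- one common rate (leaf-01's `fineHessA` lemmas share it)
  have hS' : ∀ κ u, BiLoc (coProj n S κ u) u u (|cN' 3 n δs * Cs|) (min δs δ2) := fun κ u =>
    biLoc_of_le (locStencil_coProj hn hS hδs.le κ u) (min_le_left _ _)
  have hW' : ∀ κ' u l' u', BiLoc (Wf κ' u l' u') u u' (|C2|) (min δs δ2) := fun κ' u l' u' =>
    biLoc_of_le (hW κ' u l' u') (min_le_right _ _)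
  have h := bondSecondMomentP_tsum_four (N := n) (by omega) (fun c a => colH K n a 0 c) (fineHessA (axDressK n K) (coProj n S) Wf)
    (fun c e => isBlockPeriodic_fineHessA_coarse (axDressK_blockCov hn hKcov) (coProj_translate hn hScov) hWcov c e)
    (fun κ' l => constReproSum_colH_zero (σ := fun κ' l => if κ' = l then (((n : ℝ) ^ (4 + 1))⁻¹) else 0) hw0 κ' l)
    (fun κ' l => linReproSum_colH_zero hw1 κ' l) (fun κ' l => absMoment₂_colH_zero hwA κ' l)
    (fun c e b => absMoment₂_baseKer_fineHessA (axDressK n K) hA hS' hW' hm c e b)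
    (hasSum_col_fineHessA hn hK hδ hS hδs hWsymm hrow) hrow hT1 κ lam μ ν
  rw [← h, ← (Equiv.neg (Site 4)).tsum_eq]
  refine tsum_congr fun z => ?_
  rw [TPerfOf_vertex2OfK_eq_dressedEntryP hn hK hδ hKcov hwA hS hδs hScov hW hδ2 hWcov μ ν]
  simp only [Equiv.neg_apply, Pi.neg_apply, neg_mul_neg, neg_neg]

/-- [folklore] The same in `B12Beta.secondMoment` currency: `secondMoment (TPerfOf n K S (vertex2OfK K n Wf)) … `-shape
`Σ'_z T μ ν z · z_κ · z_λ = n⁻⁸ · avgM2 n (fineHessA (Π K Π) (Πᵀ S) Wf μ ν) κ λ` — the owner's units bookkeeping constant DISPLAYED. -/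
theorem secondMoment_TPerfOf_vertex2OfK_eq (hn : 1 ≤ n) (hK : Decays K C δ) (hδ : 0 < δ)
    (hKcov : ∀ t : Fin (3 + 1) → ℤ, shiftK (-((n : ℤ) • t)) K = K)
    (hw0 : ∀ κ l : Fin 4, ConstReproSum n (colOf K κ l) (if κ = l then (((n : ℝ) ^ (4 + 1))⁻¹) else 0))
    (hw1 : ∀ κ l : Fin 4, ∃ C : Fin 4 → ℝ, LinReproSum n (colOf K κ l) C) (hwA : ∀ κ l : Fin 4, AbsMoment₂ (colOf K κ l))
    (hS : LocStencil S Cs δs) (hδs : 0 < δs) (hScov : ∀ κ u t, S κ (u + (n : ℤ) • t) = shiftK (-((n : ℤ) • t)) (S κ u))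
    (hW : ∀ κ' u l' u', BiLoc (Wf κ' u l' u') u u' C2 δ2) (hδ2 : 0 < δ2)
    (hWcov : ∀ κ' u l' u' t, Wf κ' (u + (n : ℤ) • t) l' (u' + (n : ℤ) • t) = shiftK (-((n : ℤ) • t)) (Wf κ' u l' u'))
    (hWsymm : ∀ (κ' : Fin 4) (u : Site 4) (l' : Fin 4) (u' : Site 4), Wf κ' u l' u' = Wf l' u' κ' u)
    (hrow : ∀ (κ' l' : Fin 4) (b : Site 4), HasSum (fineHessA (axDressK n K) (coProj n S) Wf κ' l' b) 0)
    (hT1 : ∀ (κ' l' μ' : Fin 4), ∑ r : Fin 4 → Fin n, ∑' t, (t μ' : ℝ) *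
      baseKer (fineHessA (axDressK n K) (coProj n S) Wf κ' l') (resSite r) t = 0)
    (κ lam μ ν : Fin 4) :
    ∑' z : Site 4, TPerfOf n K S (vertex2OfK K n Wf) μ ν z * (z κ : ℝ) * (z lam : ℝ)
      = ((n : ℝ) ^ 8)⁻¹ * avgM2 n (fineHessA (axDressK n K) (coProj n S) Wf μ ν) κ lam := by
  have hn' : (n : ℝ) ^ 8 ≠ 0 := pow_ne_zero 8 (by exact_mod_cast (show n ≠ 0 by omega))
  have h := bondSecondMoment_TPerfOf_eq_avgM2 hn hK hδ hKcov hw0 hw1 hwA hS hδs hScov hW hδ2 hWcov hWsymm hrow hT1 κ lam μ ν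
  have e : (fun z : Site 4 => ((z κ * z lam : ℤ) : ℝ) * ((n : ℝ) ^ 8 * TPerfOf n K S (vertex2OfK K n Wf) μ ν z))
      = fun z => (n : ℝ) ^ 8 * (TPerfOf n K S (vertex2OfK K n Wf) μ ν z * (z κ : ℝ) * (z lam : ℝ)) := by
    funext z; push_cast; ring
  rw [e, tsum_mul_left] at h
  rw [← h, ← mul_assoc, inv_mul_cancel₀ hn', one_mul]

end Transport

/-! ## §6 The perfect resolvent: every K-side hypothesis discharged from the tree -/

section Perfect

variable {Lc : ℕ} [NeZero Lc]

/-- [folklore] **ALG-2b (EXACT FORM) AT THE PERFECT RESOLVENT, K-SIDE HYPOTHESIS-FREE** (`d = 3`, `2 ≤ Lc`, `m ≥ 1`, `n := Lc^m`, adopted units):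
with `K := KPerf Lc (sfStep Lc) (smStep 3 Lc) m` (decay `exists_decays_KPerf_holds`, coarse invariance `shiftK_KPerf`, column letters
`entryHyps_perfCol_holds`) and ANY local coarse-covariant stencil family `S`, ANY bi-localised coarse-covariant symmetric bi-table `Wf` whose FULL
fine kernel `fineHessA (Π K Π) (Πᵀ S) Wf` has Ward rows `hrow` and vanishing base-point-summed first moments `hT1`:
`Σ'_z TPerfOf (Lc^m) K S (vertex2OfK K (Lc^m) Wf) μ ν z · z_κ · z_λ = (Lc^m)⁻⁸ · avgM2 (Lc^m) (fineHessA … μ ν) κ λ` — i.e. for `W := vertex2OfK K n Wf`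
`secondMoment (TPerfOf n K S W) …`'s shape is EXACTLY `n⁻⁸ ×` the base-point average of the fine second moment of the full fine kernel. -/
theorem secondMoment_TPerfOf_perfect_eq (hLc : 2 ≤ Lc) {m : ℕ} (hm : 1 ≤ m)
    {S : Fin (3 + 1) → (Fin (3 + 1) → ℤ) → MKer (3 + 1) (Fib 3)} {Cs δs : ℝ} (hS : LocStencil S Cs δs) (hδs : 0 < δs)
    (hScov : ∀ κ u t, S κ (u + ((Lc ^ m : ℕ) : ℤ) • t) = shiftK (-(((Lc ^ m : ℕ) : ℤ) • t)) (S κ u))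
    {Wf : Fin (3 + 1) → (Fin (3 + 1) → ℤ) → Fin (3 + 1) → (Fin (3 + 1) → ℤ) → MKer (3 + 1) (Fib 3)} {C2 δ2 : ℝ}
    (hW : ∀ κ' u l' u', BiLoc (Wf κ' u l' u') u u' C2 δ2) (hδ2 : 0 < δ2)
    (hWcov : ∀ κ' u l' u' t, Wf κ' (u + ((Lc ^ m : ℕ) : ℤ) • t) l' (u' + ((Lc ^ m : ℕ) : ℤ) • t)
      = shiftK (-(((Lc ^ m : ℕ) : ℤ) • t)) (Wf κ' u l' u'))
    (hWsymm : ∀ (κ' : Fin 4) (u : Site 4) (l' : Fin 4) (u' : Site 4), Wf κ' u l' u' = Wf l' u' κ' u)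
    (hrow : ∀ (κ' l' : Fin 4) (b : Site 4),
      HasSum (fineHessA (axDressK (Lc ^ m) (KPerf (d := 3) Lc (sfStep Lc) (smStep 3 Lc) m)) (coProj (Lc ^ m) S) Wf κ' l' b) 0)
    (hT1 : ∀ (κ' l' μ' : Fin 4), ∑ r : Fin 4 → Fin (Lc ^ m), ∑' t, (t μ' : ℝ) *
      baseKer (fineHessA (axDressK (Lc ^ m) (KPerf (d := 3) Lc (sfStep Lc) (smStep 3 Lc) m)) (coProj (Lc ^ m) S) Wf κ' l')
        (resSite r) t = 0)
    (κ lam μ ν : Fin 4) :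
    ∑' z : Site 4, TPerfOf (Lc ^ m) (KPerf (d := 3) Lc (sfStep Lc) (smStep 3 Lc) m) S
        (vertex2OfK (KPerf (d := 3) Lc (sfStep Lc) (smStep 3 Lc) m) (Lc ^ m) Wf) μ ν z * (z κ : ℝ) * (z lam : ℝ)
      = ((((Lc ^ m : ℕ) : ℝ)) ^ 8)⁻¹ *
          avgM2 (Lc ^ m) (fineHessA (axDressK (Lc ^ m) (KPerf (d := 3) Lc (sfStep Lc) (smStep 3 Lc) m)) (coProj (Lc ^ m) S) Wf μ ν)
            κ lam := by
  have hn : 1 ≤ Lc ^ m := Nat.one_le_pow _ _ (by omega)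
  obtain ⟨CK, δK, hδK, hK⟩ := exists_decays_KPerf_holds hLc hm
  have hE := entryHyps_perfCol_zero hLc hm
  have h := secondMoment_TPerfOf_vertex2OfK_eq (n := Lc ^ m) hn hK hδK (fun t => shiftK_KPerf Lc (sfStep Lc) (smStep 3 Lc) m t)
    hE.const hE.lin hE.absW hS hδs (by exact_mod_cast hScov) hW hδ2 (by exact_mod_cast hWcov) hWsymm hrow hT1 κ lam μ ν
  simpa using h

end Perfect

end

end Summit.QuantumFields.BalabanUV.Beta.FP.PerfectFullSandwich
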